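import Mathlib
import Summits.ValiantsHypothesis.ValiantsHypothesis.Theorems.FeketeSOSFeketeNoSparseSplitCharPFewnomial

/-!
# Crux `FeketeSOS.CharPSparseSOS` (stmt-ValiantsHypothesis-14989), line `Sketch` — the two-cusp
inequality for at most two squares (`s ≤ 2`) with the LINEAR exponent

For a non-zero fold `P = (Σ_{i<s} c_i g_i²) mod (X^p − 1)` over a field `K` of characteristic `p` with
`deg g_i < p` and `s ≤ 2`, depth `D` at the upper cusp (`(X − 1)^D ∣ P`) already forces
`D + 2 ≤ 2 · Σ_i #supp g_i` (sub-goal `twoCuspInequality_s_le_two` of the load-bearing stub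
`stub_twoCuspInequality`; the lower cusp is not needed here).

Proof.  `P ≠ 0` gives `D ≤ deg P < p`, and `X^p − 1 = (X − 1)^p` in characteristic `p`, so `(X − 1)^D`
divides the un-folded sum `F = Σ c_i g_i² = P + (X^p − 1) · (F / (X^p − 1))` as well.
* One live square `c g²`: `(X − 1)^D ∣ g · g`, so `D ≤ 2 · ord₁ g ≤ 2 (#supp g − 1)` by the char-`p`
  fewnomial (Hajós) bound `cpf_main` (`tcs_depth_mul_le`, `tcs_depth_sq_le`).
* Two live squares `c₀ g₀² + c₁ g₁²`: if `c₀ r² + c₁ = 0` for some `r ∈ K`, then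
  `F = c₀ (g₀ + r g₁)(g₀ − r g₁)` is a product of two non-zero polynomials of degree `< p` with at most
  `T = #supp g₀ + #supp g₁` monomials each, so `D ≤ ord₁ + ord₁ ≤ 2T − 2` (`tcs_depth_mul_le`);
  otherwise the binary form `c₀ a² + c₁ b²` is anisotropic, the leading `(X − 1)`-adic terms of the two
  squares cannot cancel, and `D ≤ 2 · min(ord₁ g₀, ord₁ g₁) ≤ 2T − 2` (`tcs_depth_aniso_le`).
-/

-- `Summit.ValiantsHypothesis.ValiantsHypothesis.…` is the tree's mandated single-conjunct layout (Sub = Summit).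
set_option linter.dupNamespace false

namespace Summit.ValiantsHypothesis.ValiantsHypothesis.Theorems.CharPSparseSOSTwoCusp

open Polynomial Finset
open Summit.ValiantsHypothesis.ValiantsHypothesis.Theorems.FeketeNoSparseSplitCyclic (cpf_main)

/-- **Product form of the char-`p` fewnomial bound.**  If `(X − 1)^D` divides a product `u · v` of two
non-zero polynomials of degree `< p` over a field of characteristic `p`, then `D + 2 ≤ #supp u + #supp v`
(`D ≤ ord₁ u + ord₁ v`, and `ord₁ w + 1 ≤ #supp w` by `cpf_main`). -/
theorem tcs_depth_mul_le (K : Type) [Field K] (p : ℕ) [CharP K p] (u v : K[X]) (D : ℕ)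
    (hu : u ≠ 0) (hv : v ≠ 0) (hdu : u.natDegree < p) (hdv : v.natDegree < p)
    (hD : (X - C (1 : K)) ^ D ∣ u * v) :
    D + 2 ≤ u.support.card + v.support.card := by
  have huv : u * v ≠ 0 := mul_ne_zero hu hv
  have hle : D ≤ (u * v).rootMultiplicity 1 := (le_rootMultiplicity_iff huv).2 hD
  rw [rootMultiplicity_mul huv] at hle
  have h1 : u.rootMultiplicity 1 + 1 ≤ u.support.card :=
    cpf_main K p _ u hu hdu (pow_rootMultiplicity_dvd u 1)
  have h2 : v.rootMultiplicity 1 + 1 ≤ v.support.card :=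
    cpf_main K p _ v hv hdv (pow_rootMultiplicity_dvd v 1)
  omega

/-- **One weighted square.**  If `c · g² ≠ 0`, `deg g < p` and `(X − 1)^D ∣ c · g²` over a field of
characteristic `p`, then `D + 2 ≤ 2 · #supp g`. -/
theorem tcs_depth_sq_le (K : Type) [Field K] (p : ℕ) [CharP K p] (c : K) (g : K[X]) (D : ℕ)
    (hF : C c * g ^ 2 ≠ 0) (hdeg : g.natDegree < p) (hD : (X - C (1 : K)) ^ D ∣ C c * g ^ 2) :
    D + 2 ≤ 2 * g.support.card := by
  have hc : c ≠ 0 := by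
    rintro rfl
    exact hF (by rw [C_0, zero_mul])
  have hg : g ≠ 0 := by
    rintro rfl
    exact hF (by rw [zero_pow two_ne_zero, mul_zero])
  rw [(isUnit_C.2 hc.isUnit).dvd_mul_left, sq] at hD
  have h := tcs_depth_mul_le K p g g D hg hg hdeg hdeg hD
  omega

/-- **Two weighted squares with anisotropic weights.**  If `c₀ a² + c₁ b² = 0` forces `a = 0` in `K`,
`g₀ ≠ 0` has degree `< p` and `(X − 1)`-order `ord₁ g₀ ≤ ord₁ g₁`, and `(X − 1)^D ∣ c₀ g₀² + c₁ g₁²`, then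
`D ≤ 2 · ord₁ g₀`, whence `D + 2 ≤ 2 · #supp g₀` by `cpf_main`: writing `g_i = (X − 1)^m h_i` with
`m = ord₁ g₀` and `h₀(1) ≠ 0`, divisibility by `(X − 1)^{2m+1}` would give `c₀ h₀(1)² + c₁ h₁(1)² = 0`. -/
theorem tcs_depth_aniso_le (K : Type) [Field K] (p : ℕ) [CharP K p] (c₀ c₁ : K) (g₀ g₁ : K[X]) (D : ℕ)
    (hg₀ : g₀ ≠ 0) (hdeg : g₀.natDegree < p) (hle : g₀.rootMultiplicity 1 ≤ g₁.rootMultiplicity 1)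
    (hns : ∀ a b : K, c₀ * a ^ 2 + c₁ * b ^ 2 = 0 → a = 0)
    (hD : (X - C (1 : K)) ^ D ∣ C c₀ * g₀ ^ 2 + C c₁ * g₁ ^ 2) :
    D + 2 ≤ 2 * g₀.support.card := by
  obtain ⟨m, hm⟩ : ∃ m : ℕ, g₀.rootMultiplicity 1 = m := ⟨_, rfl⟩
  have hMmonic : ((X - C (1 : K)) ^ m).Monic := (monic_X_sub_C (1 : K)).pow m
  have hdvd₀ : (X - C (1 : K)) ^ m ∣ g₀ := by
    rw [← hm]
    exact pow_rootMultiplicity_dvd g₀ 1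
  have hdvd₁ : (X - C (1 : K)) ^ m ∣ g₁ :=
    (pow_dvd_pow _ (hm ▸ hle)).trans (pow_rootMultiplicity_dvd g₁ 1)
  -- `g_i = (X − 1)^m · (g_i /ₘ (X − 1)^m)`, and the cofactor of `g₀` does not vanish at `1`.
  have hfac : ∀ f : K[X], (X - C (1 : K)) ^ m ∣ f →
      (X - C (1 : K)) ^ m * (f /ₘ (X - C (1 : K)) ^ m) = f := fun f hf => by
    have h := modByMonic_add_div f ((X - C (1 : K)) ^ m)
    rwa [(modByMonic_eq_zero_iff_dvd hMmonic).2 hf, zero_add] at h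
  have ha₀ : (g₀ /ₘ (X - C (1 : K)) ^ m).eval 1 ≠ 0 := by
    rw [← hm]
    exact eval_divByMonic_pow_rootMultiplicity_ne_zero 1 hg₀
  -- Hajós bound for `g₀`.
  have hcard : m + 1 ≤ g₀.support.card := cpf_main K p m g₀ hg₀ hdeg hdvd₀
  -- `D ≤ 2m`: otherwise `(X − 1) ∣ c₀ h₀² + c₁ h₁²`, whose value at `1` is `c₀ h₀(1)² + c₁ h₁(1)²`.
  suffices hD2m : D ≤ 2 * m by omega
  by_contra hlt
  rw [not_le] at hlt
  have hdvd : (X - C (1 : K)) ^ (2 * m + 1) ∣ C c₀ * g₀ ^ 2 + C c₁ * g₁ ^ 2 :=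
    (pow_dvd_pow _ (Nat.succ_le_of_lt hlt)).trans hD
  have hpow : (X - C (1 : K)) ^ (2 * m + 1) = ((X - C (1 : K)) ^ m) ^ 2 * (X - C 1) := by
    rw [pow_succ (X - C (1 : K)) (2 * m), pow_mul' (X - C (1 : K)) 2 m]
  have hS : C c₀ * g₀ ^ 2 + C c₁ * g₁ ^ 2 = ((X - C (1 : K)) ^ m) ^ 2 *
      (C c₀ * (g₀ /ₘ (X - C (1 : K)) ^ m) ^ 2 + C c₁ * (g₁ /ₘ (X - C (1 : K)) ^ m) ^ 2) :=
    calc C c₀ * g₀ ^ 2 + C c₁ * g₁ ^ 2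
        = C c₀ * ((X - C (1 : K)) ^ m * (g₀ /ₘ (X - C (1 : K)) ^ m)) ^ 2
            + C c₁ * ((X - C (1 : K)) ^ m * (g₁ /ₘ (X - C (1 : K)) ^ m)) ^ 2 := by
          rw [hfac g₀ hdvd₀, hfac g₁ hdvd₁]
      _ = _ := by ring
  rw [hpow, hS, mul_dvd_mul_iff_left (pow_ne_zero 2 hMmonic.ne_zero), dvd_iff_isRoot] at hdvd
  have h := hdvd.eq_zero
  simp only [eval_add, eval_mul, eval_C, eval_pow] at h
  exact ha₀ (hns _ _ h)

/-- **Two-cusp inequality for `s ≤ 2` squares, linear exponent.**  Over a field `K` of characteristic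
`p`, if the fold `P = (Σ_{i<s} c_i g_i²) mod (X^p − 1)` with `s ≤ 2` and `deg g_i < p` is non-zero and
`(X − 1)^D ∣ P`, then `D + 2 ≤ 2 · Σ_i #supp g_i`. -/
theorem twoCuspInequality_s_le_two :
    ∀ (K : Type) [Field K] (p : ℕ) [Fact p.Prime] [CharP K p] (s : ℕ) (c : Fin s → K) (g : Fin s → K[X])
      (P : K[X]) (D : ℕ), s ≤ 2 → (∀ i, (g i).natDegree < p) → P = (∑ i, C (c i) * g i ^ 2) %ₘ (X ^ p - 1) →
      P ≠ 0 → (X - C (1 : K)) ^ D ∣ P → D + 2 ≤ 2 * ∑ i, (g i).support.card := by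
  intro K _ p _ _ s c g P D hs hdeg hP hP0 hD
  have hprime : p.Prime := Fact.out
  have hp : 0 < p := hprime.pos
  have hmonic : ((X : K[X]) ^ p - 1).Monic :=
    monic_X_pow_sub (by rw [degree_one]; exact_mod_cast hp)
  -- `deg P < p`, hence `D ≤ deg P < p`.
  have hdegP : P.natDegree < p := by
    have hq1 : ((X : K[X]) ^ p - 1) ≠ 1 := by
      intro h
      have := congrArg natDegree h
      rw [← C_1, natDegree_X_pow_sub_C, natDegree_C] at this
      omega
    have h := natDegree_modByMonic_lt (∑ i, C (c i) * g i ^ 2) hmonic hq1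
    rw [← C_1, natDegree_X_pow_sub_C] at h
    rw [hP, ← C_1]; exact h
  have hDp : D ≤ p := by
    have h := natDegree_le_of_dvd hD hP0
    rw [(monic_X_sub_C (1 : K)).natDegree_pow, natDegree_X_sub_C, mul_one] at h
    omega
  -- Frobenius: `X^p − 1 = (X − 1)^p`, so `(X − 1)^D` divides the un-folded sum `F` as well.
  have hXp : (X - C (1 : K)) ^ p = X ^ p - 1 := by
    rw [sub_pow_char, ← C_pow, one_pow, C_1]
  have hF0 : (∑ i, C (c i) * g i ^ 2) ≠ 0 := by
    intro h
    rw [h, zero_modByMonic] at hP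
    exact hP0 hP
  have hDF : (X - C (1 : K)) ^ D ∣ ∑ i, C (c i) * g i ^ 2 := by
    rw [← modByMonic_add_div (∑ i, C (c i) * g i ^ 2) ((X : K[X]) ^ p - 1), ← hP]
    refine dvd_add hD (dvd_mul_of_dvd_left ?_ _)
    rw [← hXp]
    exact pow_dvd_pow _ hDp
  clear hD hdegP hDp
  -- Case analysis on `s ∈ {0, 1, 2}`.
  obtain rfl | rfl | rfl : s = 0 ∨ s = 1 ∨ s = 2 := by omega
  · exact (hF0 (by simp)).elim
  · rw [Fin.sum_univ_one] at hF0 hDF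
    rw [Fin.sum_univ_one]
    exact tcs_depth_sq_le K p (c 0) (g 0) D hF0 (hdeg 0) hDF
  · rw [Fin.sum_univ_two] at hF0 hDF
    rw [Fin.sum_univ_two]
    -- A dead square reduces to the one-square case.
    by_cases hz0 : C (c 0) * g 0 ^ 2 = 0
    · rw [hz0, zero_add] at hF0 hDF
      have h := tcs_depth_sq_le K p (c 1) (g 1) D hF0 (hdeg 1) hDF
      omega
    by_cases hz1 : C (c 1) * g 1 ^ 2 = 0
    · rw [hz1, add_zero] at hF0 hDF
      have h := tcs_depth_sq_le K p (c 0) (g 0) D hF0 (hdeg 0) hDF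
      omega
    have hc0 : c 0 ≠ 0 := fun h => hz0 (by rw [h, C_0, zero_mul])
    have hg0 : g 0 ≠ 0 := fun h => hz0 (by rw [h, zero_pow two_ne_zero, mul_zero])
    have hg1 : g 1 ≠ 0 := fun h => hz1 (by rw [h, zero_pow two_ne_zero, mul_zero])
    by_cases hsq : ∃ r : K, c 0 * r ^ 2 + c 1 = 0
    · -- Isotropic weights: `F = c₀ (g₀ + r g₁) (g₀ − r g₁)`.
      obtain ⟨r, hr⟩ := hsq
      have hc1r : c 1 = -(c 0 * r ^ 2) := by linear_combination hr
      have hFuv : C (c 0) * g 0 ^ 2 + C (c 1) * g 1 ^ 2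
          = C (c 0) * ((g 0 + C r * g 1) * (g 0 + C (-r) * g 1)) := by
        rw [hc1r]
        simp only [map_neg, map_mul, map_pow]
        ring
      rw [hFuv] at hF0 hDF
      rw [(isUnit_C.2 hc0.isUnit).dvd_mul_left] at hDF
      have hw : ∀ t : K, (g 0 + C t * g 1).natDegree < p ∧
          (g 0 + C t * g 1).support.card ≤ (g 0).support.card + (g 1).support.card := fun t => by
        refine ⟨lt_of_le_of_lt (natDegree_add_le _ _)
          (max_lt (hdeg 0) (lt_of_le_of_lt (natDegree_C_mul_le _ _) (hdeg 1))), ?_⟩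
        calc (g 0 + C t * g 1).support.card
            ≤ ((g 0).support ∪ (C t * g 1).support).card := card_le_card support_add
          _ ≤ (g 0).support.card + (C t * g 1).support.card := card_union_le _ _
          _ ≤ (g 0).support.card + (g 1).support.card := by
            rw [C_mul']
            exact Nat.add_le_add_left (card_le_card (support_smul t (g 1))) _
      have hu0 : g 0 + C r * g 1 ≠ 0 := fun h => hF0 (by rw [h, zero_mul, mul_zero])
      have hv0 : g 0 + C (-r) * g 1 ≠ 0 := fun h => hF0 (by rw [h, mul_zero, mul_zero])
      have h := tcs_depth_mul_le K p _ _ D hu0 hv0 (hw r).1 (hw (-r)).1 hDF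
      have h1 := (hw r).2
      have h2 := (hw (-r)).2
      omega
    · -- Anisotropic weights: the square of smaller `(X − 1)`-order controls the depth.
      push Not at hsq
      have hns : ∀ a b : K, c 0 * a ^ 2 + c 1 * b ^ 2 = 0 → a = 0 ∧ b = 0 := by
        intro a b hab
        have hb : b = 0 := by
          by_contra hb
          refine hsq (a / b) ?_
          have h : c 0 * (a / b) ^ 2 + c 1 = (c 0 * a ^ 2 + c 1 * b ^ 2) / b ^ 2 := by
            field_simp
          rw [h, hab, zero_div]
        subst hb
        have ha : c 0 * a ^ 2 = 0 := by simpa using hab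
        exact ⟨pow_eq_zero_iff two_ne_zero |>.1 ((mul_eq_zero.1 ha).resolve_left hc0), rfl⟩
      rcases le_total ((g 0).rootMultiplicity 1) ((g 1).rootMultiplicity 1) with hle | hle
      · have h := tcs_depth_aniso_le K p (c 0) (c 1) (g 0) (g 1) D hg0 (hdeg 0) hle
          (fun a b hab => (hns a b hab).1) hDF
        omega
      · rw [add_comm] at hDF
        have h := tcs_depth_aniso_le K p (c 1) (c 0) (g 1) (g 0) D hg1 (hdeg 1) hle
          (fun a b hab => (hns b a (by linear_combination hab)).2) hDF
        omega

end Summit.ValiantsHypothesis.ValiantsHypothesis.Theorems.CharPSparseSOSTwoCusp
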